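import Summits.FinalStateConjecture.FinalStateConjecture.Theorems.SwallowTheDatumUniversalWitnessFamilyStubSocketBagOfPlugDataPlusFrom
import HarnessLib

/-!
# Stub `stub_universalSocketBag_of_plugDataPlusSharp` of the line `Sketch` (crux
# `SwallowTheDatum.UniversalWitnessFamily`, item stmt-FinalStateConjecture-10051): from the sharp
# PlugData⁺ to the DEEP universal socket bag (route item stmt-FinalStateConjecture-15426 verbatim)

The hypothesis (sharp PlugData⁺ with the exterior mass `M` prescribed) provides, for every `μ₀ > 0`
and `M > 0`, an everywhere-vacuum datum `D₀` on `E3 = ℝ³` which is EXACTLY time-symmetric isotropic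
Schwarzschild(`M`), `((1 + M/2‖y‖)⁴ δ, 0)`, on `{‖y‖ > ρ₃}` (`ρ₃ < M/40`) and, on the small annulus
`{λ < ‖y‖ < 2λ}` (`16384 λ < ρ₃`), the NON-canonically normalised socket
`(λ⁻² (1 + λμ/2‖y‖)⁴ δ, 0)`, `0 < μ ≤ μ₀`.  The conclusion is the DEEP UNIVERSAL SOCKET BAG of the
line (route item 15426, vocabulary inlined): a datum `C` on `E3`, vacuum off the unit ball, exactly
the canonical socket `((1 + μ/2‖y‖)⁴ δ, 0)` on `{1 < ‖y‖ < 2}` and exactly Schwarzschild(`M`) beyond a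
radius `R₁` with `2 < R₁` and `40 R₁ < M` (through the throat `‖y‖ = M/2` and on a sheet-2 collar).

PROOF (the landed open-sheet proof `stub_socketBag_of_plugDataPlusFrom` with new constants).  Take
`M := 160` (so `ρ₃ < 4`, `λ < 1/4096`) and pull `D₀` back (`InitialDataSet.comap`, Bartnik–Isenberg
2004 §2: the constraint map is diffeomorphism-equivariant, `isVacuumConstraintSolution_comap'`) along
the RADIAL STRETCH `Φ z = G(‖z‖²) z` of `E3` (`exists_stretchProfile`: `G = λ` for `t ≤ 5`, `G = 1`
for `t ≥ 15`, smooth, non-decreasing, `≥ λ`).  `Φ` is a smooth immersion, it is the homothety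
`z ↦ λ z` near the socket annulus `{1 < ‖z‖ < 2}` (whence `C = Φ^* D₀` reads
`λ² · λ⁻² (1 + λμ/(2λ‖z‖))⁴ δ = (1 + μ/2‖z‖)⁴ δ`, `k = 0` there) and the identity near
`{‖z‖ > R₁}`, `R₁ := max 3.9 ρ₃ ≥ √15` (whence `C = D₀ =` Schwarzschild(`160`) there, as
`R₁ ≥ ρ₃`); finally `2 < 3.9 ≤ R₁` and `40 R₁ < 160` because `ρ₃ < 4`.
References: Bartnik–Isenberg 2004 §2; Misner–Thorne–Wheeler 1973 (31.22); the skeleton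
`Cruxes/UniversalWitnessFamily/Lines/Sketch.lean`; route item stmt-FinalStateConjecture-15426.
-/

-- `Summit.<Summit>.<Problem>` is the tree's mandated summit-side namespace (CONVENTIONS §2); for this
-- single-conjunct summit the two coincide, so the duplicate is deliberate.
set_option linter.dupNamespace false

noncomputable section

namespace Summit.FinalStateConjecture.FinalStateConjecture.Theorems.SwallowTheDatum.UniversalWitnessFamily

open scoped Manifold ContDiff Topology InnerProductSpace
open Set Filter Function Literature.Geometry.Lorentzian Literature.Geometry.Lorentzian.InitialDataSet

/-- **Stub `stub_universalSocketBag_of_plugDataPlusSharp`: from the sharp PlugData⁺ (exterior mass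
prescribed, `16384 λ < ρ₃`) to the DEEP universal socket bag (route item 15426 verbatim).** Apply
the hypothesis at `μ₀` and `M := 160`, and pull the everywhere-vacuum datum `D₀` back along the
radial stretch `Φ z = G(‖z‖²) z` (`G = λ` for `‖z‖² ≤ 5`, `G = 1` for `‖z‖² ≥ 15`, smooth,
non-decreasing, `≥ λ`): the pullback is vacuum everywhere (diffeomorphism equivariance of the
constraints, Bartnik–Isenberg 2004 §2), equals the canonical socket `((1 + μ/2‖z‖)⁴ δ, 0)` on
`{1 < ‖z‖ < 2}` (there `Φ = λ · id`, `dΦ = λ · id`, and `λ² λ⁻² (1 + λμ/(2λ‖z‖))⁴ = (1 + μ/2‖z‖)⁴`)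
and Schwarzschild(`160`) beyond `R₁ := max 3.9 ρ₃` (there `Φ = id`, as `R₁² ≥ 15`, and `R₁ ≥ ρ₃`);
`2 < R₁`, `40 R₁ < 160` since `ρ₃ < 160/40 = 4`. [cite: BartnikIsenberg2004, §2] -/
theorem stub_universalSocketBag_of_plugDataPlusSharp :
  (∀ μ₀ : ℝ, 0 < μ₀ → ∀ M : ℝ, 0 < M →
      ∃ (μ ρ₃ lam : ℝ) (D₀ : InitialDataSet (𝓡 3) E3),
        0 < μ ∧ μ ≤ μ₀ ∧ 0 < ρ₃ ∧ ρ₃ < M / 40 ∧ 0 < lam ∧ 16384 * lam < ρ₃ ∧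
        (∀ [D₀.metric.HasLeviCivita], D₀.IsVacuumConstraintSolution) ∧
        (∀ y : E3, ρ₃ < ‖y‖ →
          (∀ v w : E3, D₀.h.inner y v w = Schwarzschild.conformalFactor M y ^ 4 * ⟪v, w⟫_ℝ) ∧ D₀.k y = 0) ∧
        (∀ y : E3, lam < ‖y‖ → ‖y‖ < 2 * lam →
          (∀ v w : E3, D₀.h.inner y v w = (lam ^ 2)⁻¹ * (1 + lam * μ / (2 * ‖y‖)) ^ 4 * ⟪v, w⟫_ℝ) ∧ D₀.k y = 0)) →
  ∀ μ₀ : ℝ, 0 < μ₀ → ∃ μ : ℝ, 0 < μ ∧ μ ≤ μ₀ ∧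
    ∃ (M R₁ : ℝ) (C : InitialDataSet (𝓡 3) E3), 2 < R₁ ∧ 40 * R₁ < M ∧
      (∀ [C.metric.HasLeviCivita], ∀ y ∈ {y : E3 | 1 < ‖y‖},
        C.hamiltonianConstraintFn y = 0 ∧ C.momentumConstraintFn y = 0) ∧
      (∀ y : E3, 1 < ‖y‖ → ‖y‖ < 2 →
        C.h.inner y = (1 + μ / (2 * ‖y‖)) ^ 4 • (innerSL ℝ : E3 →L[ℝ] E3 →L[ℝ] ℝ) ∧ C.k y = 0) ∧
      ∀ y : E3, R₁ < ‖y‖ →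
        C.h.inner y = (1 + M / (2 * ‖y‖)) ^ 4 • (innerSL ℝ : E3 →L[ℝ] E3 →L[ℝ] ℝ) ∧ C.k y = 0 := by
  intro hplug μ₀ hμ₀
  obtain ⟨μ, ρ₃, lam, D₀, hμ, hμμ₀, -, hρ₃M, hlam, hlamρ, hvac, hext, hsock⟩ :=
    hplug μ₀ hμ₀ 160 (by norm_num)
  have hρ₃4 : ρ₃ < 4 := by linarith
  have hlam1 : lam ≤ 1 := by linarith
  obtain ⟨G, hGs, hGm, hGlam, hG5, hG15⟩ := exists_stretchProfile hlam1
  -- the radial stretch and the pulled-back datum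
  have hΦ : ContMDiff (𝓡 3) (𝓡 3) (∞ + 1) (fun z : E3 ↦ G (‖z‖ ^ 2) • z) := contMDiff_stretch hGs
  have hΦ' : ∀ z, Injective (mfderiv (𝓡 3) (𝓡 3) (fun z : E3 ↦ G (‖z‖ ^ 2) • z) z) :=
    injective_mfderiv_stretch hGs hGm hlam hGlam
  -- the deep radius `R₁ := max 3.9 ρ₃`: `√15 < 3.9 ≤ R₁`, `ρ₃ ≤ R₁`, `2 < R₁ < 4`
  have hR2 : (2 : ℝ) < max 3.9 ρ₃ := lt_of_lt_of_le (by norm_num) (le_max_left _ _)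
  have hR40 : 40 * max 3.9 ρ₃ < 160 := by
    rcases le_total 3.9 ρ₃ with h | h
    · rw [max_eq_right h]; linarith
    · rw [max_eq_left h]; norm_num
  refine ⟨μ, hμ, hμμ₀, 160, max 3.9 ρ₃, D₀.comap (fun z : E3 ↦ G (‖z‖ ^ 2) • z) hΦ hΦ', hR2, hR40,
    ?_, ?_, ?_⟩
  · -- vacuum everywhere, in particular off the unit ball
    intro inst y _
    haveI := D₀.metric.hasLeviCivita
    exact (D₀.isVacuumConstraintSolution_comap' hΦ hΦ' hvac) y
  · -- the canonical socket annulus `{1 < ‖z‖ < 2}`: there `Φ = λ · id`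
    intro z hz1 hz2
    have hz5 : ‖z‖ ^ 2 < 5 := by nlinarith
    have hev : ∀ᶠ y in 𝓝 z, G (‖y‖ ^ 2) = lam := by
      have ho : IsOpen {y : E3 | ‖y‖ ^ 2 < 5} := isOpen_lt (continuous_norm.pow 2) continuous_const
      filter_upwards [ho.mem_nhds hz5] with y hy
      exact hG5 _ (le_of_lt hy)
    have hd : ∀ v : E3, mfderiv (𝓡 3) (𝓡 3) (fun z : E3 ↦ G (‖z‖ ^ 2) • z) z v = lam • v :=
      mfderiv_stretch_apply_of_eventually hev
    have hn : ‖G (‖z‖ ^ 2) • z‖ = lam * ‖z‖ := by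
      rw [hG5 _ hz5.le, norm_smul, Real.norm_eq_abs, abs_of_pos hlam]
    have h1 : lam < ‖G (‖z‖ ^ 2) • z‖ := by rw [hn]; nlinarith
    have h2 : ‖G (‖z‖ ^ 2) • z‖ < 2 * lam := by rw [hn]; nlinarith
    obtain ⟨hh, hk⟩ := hsock _ h1 h2
    have hl : lam ≠ 0 := hlam.ne'
    have hhE : (D₀.comap (fun z : E3 ↦ G (‖z‖ ^ 2) • z) hΦ hΦ').coordH z =
        (1 + μ / (2 * ‖z‖)) ^ 4 • (innerSL ℝ : E3 →L[ℝ] E3 →L[ℝ] ℝ) := by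
      ext v w
      show (D₀.comap (fun z : E3 ↦ G (‖z‖ ^ 2) • z) hΦ hΦ').h.inner z v w =
        (1 + μ / (2 * ‖z‖)) ^ 4 * ⟪v, w⟫_ℝ
      rw [comap_h_inner_of_mfderiv D₀ hΦ hΦ' hd, hh v w, hn, mul_left_comm (2 : ℝ) lam ‖z‖,
        mul_div_mul_left μ (2 * ‖z‖) hl, ← mul_assoc, ← mul_assoc,
        mul_inv_cancel₀ (pow_ne_zero 2 hl), one_mul]
    exact ⟨hhE, comap_k_eq_zero D₀ hΦ hΦ' hk⟩
  · -- the deep exterior `{‖z‖ > R₁}`, `R₁ ≥ 3.9 > √15`, `R₁ ≥ ρ₃`: there `Φ = id` and `D₀` is exact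
    intro z hz
    have hz39 : (3.9 : ℝ) < ‖z‖ := lt_of_le_of_lt (le_max_left _ _) hz
    have hzρ : ρ₃ < ‖z‖ := lt_of_le_of_lt (le_max_right _ _) hz
    have hz15 : 15 < ‖z‖ ^ 2 := by nlinarith
    have hev : ∀ᶠ y in 𝓝 z, G (‖y‖ ^ 2) = 1 := by
      have ho : IsOpen {y : E3 | 15 < ‖y‖ ^ 2} := isOpen_lt continuous_const (continuous_norm.pow 2)
      filter_upwards [ho.mem_nhds hz15] with y hy
      exact hG15 _ (le_of_lt hy)
    have hd : ∀ v : E3, mfderiv (𝓡 3) (𝓡 3) (fun z : E3 ↦ G (‖z‖ ^ 2) • z) z v = (1 : ℝ) • v :=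
      mfderiv_stretch_apply_of_eventually hev
    have hΦz : G (‖z‖ ^ 2) • z = z := by rw [hG15 _ hz15.le, one_smul]
    have h1 : ρ₃ < ‖G (‖z‖ ^ 2) • z‖ := by rw [hΦz]; exact hzρ
    obtain ⟨hh, hk⟩ := hext _ h1
    have hhE : (D₀.comap (fun z : E3 ↦ G (‖z‖ ^ 2) • z) hΦ hΦ').coordH z =
        (1 + 160 / (2 * ‖z‖)) ^ 4 • (innerSL ℝ : E3 →L[ℝ] E3 →L[ℝ] ℝ) := by
      ext v w
      show (D₀.comap (fun z : E3 ↦ G (‖z‖ ^ 2) • z) hΦ hΦ').h.inner z v w =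
        (1 + 160 / (2 * ‖z‖)) ^ 4 * ⟪v, w⟫_ℝ
      rw [comap_h_inner_of_mfderiv D₀ hΦ hΦ' hd, hh v w, Schwarzschild.conformalFactor_apply, hΦz,
        one_pow, one_mul]
    exact ⟨hhE, comap_k_eq_zero D₀ hΦ hΦ' hk⟩

end Summit.FinalStateConjecture.FinalStateConjecture.Theorems.SwallowTheDatum.UniversalWitnessFamily

end
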